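import Summits.AnomalousDissipation.AnomalousDissipation.Theorems.SolenoidalFractalHomogenisationLagrangianStepSidebandXDefectAlgebra
import Summits.AnomalousDissipation.AnomalousDissipation.Theorems.SolenoidalFractalHomogenisationLagrangianStepSidebandResponseUnique
import HarnessLib

/-!
# K1L_D `LagrangianRenormalisationStepDesign` (stmt-AnomalousDissipation-27980), `stub_D1_V0` (V0 = clause (ii) of
# `WCrossing.D1ExactFamily`), brick T4c-3 (small groups): THE SOURCE DEFECT `D2` IS `O(|ξ|²)`, THE FEEDBACK AND THE SLOW RATE ARE BOUNDED
# (helper; `--kind proof --supports stmt-AnomalousDissipation-27980 --as helper`)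

Summits-side helper file of route `SolenoidalFractalHomogenisation` (prover seat `ad-k1l-cellLawV-w1` g6).  Everything proved; no definitions, no named
facts, no sorry.  Bounds for the defect groups D2 and D3 of `…SidebandXResidual.hasDerivWithinAt_residual`
(memo `Cruxes/LagrangianRenormalisationStepDesign/Lines/onelevel-V0-residual.md` §3):
* `norm_coordL_le` — `‖coordL_w y‖ ≤ ‖y‖`; **`norm_feedback_apply_le`** — `‖feedbackⱼ(t) y‖ ≤ 4π‖αⱼ‖·‖y‖`;
* **`norm_sourceX_sub_projX_source_le`** — `‖sourceXⱼ(t) x − projX (sourceⱼ(t) x)‖ ≤ 4π‖αⱼ‖·(√|ℓ|²/(n·√|mⱼ|²))·‖x‖`: the finite-ξ source differs from the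
  class projection of the `ξ = 0` source by `c•P_{k_{±mⱼ}}(x − P_{±mⱼ} x)`, `O(|ξ|/|mⱼ|)` (`…DefectAlgebra.norm_transversalProj_sub_proj_le`);
* **`norm_slowRHS_le`** — the slow rate `ẋ = −4π²P_ℓT_{𝔹ᵀ}(ℓ)x − Σⱼ ξⱼ•P_ℓ feedbackⱼ Z` of `…SidebandXChain.hasDerivAt_slowRep` obeys
  `‖ẋ‖ ≤ 4π²(hi'+β'/2)|ℓ|²‖x‖ + (Σⱼ |ξⱼ|·4π‖αⱼ‖)·‖Z‖` for `x ⊥ ℓ`, `NearIso 𝔹 lo' hi'` (`lo', hi' ≥ 0`), `OddSmall 𝔹 β'` (`ThreeMode.norm_modalAdjGen_le`).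
NOT a proof of any registered stub, of K1L_D, or of anomalous dissipation; rung F-D1.A0 infrastructure.
-/

set_option linter.dupNamespace false

noncomputable section

namespace Summit.AnomalousDissipation.AnomalousDissipation.Theorems.SolenoidalFractalHomogenisation.LagrangianStep.Sideband

open Set MeasureTheory Complex UnitAddTorus
open scoped InnerProductSpace
open Literature.Analysis Literature.Analysis.FunctionSpaces Literature.Analysis.FunctionSpaces.Torus
open Literature.Analysis.FluidPDE Literature.Analysis.FluidPDE.Torus Literature.Analysis.FluidPDE.LatticeShear
open Summit.AnomalousDissipation.AnomalousDissipation.Theorems.SolenoidalFractalHomogenisation.LagrangianStep.CellChain (norm_transversalProj_le)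

variable {k₀ : ℕ}

/-! ## §1 The feedback functional is bounded -/

/-- `‖coordL_w y‖ ≤ ‖y‖`. [folklore] -/
theorem norm_coordL_le {R : ℕ} (w : Fin 3 → ℤ) (y : Space R) : ‖coordL R w y‖ ≤ ‖y‖ := by
  by_cases hw : w ∈ box R
  · rw [coordL_apply_of_mem hw]; exact PiLp.norm_apply_le y ⟨w, hw⟩
  · rw [coordL_apply_of_not_mem hw, norm_zero]; exact norm_nonneg _

/-- **`‖feedbackⱼ(t) y‖ ≤ 4π‖αⱼ‖·‖y‖`** (envelope in `[0,1]`, two fibres). [cite: MajdaKramer1999, §2.2.1.3 (55)] -/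
theorem norm_feedback_apply_le (W₁ : LatticeWord k₀) (R : ℕ) (j : Fin k₀) (t : ℝ) (y : Space R) :
    ‖feedback W₁ R j t y‖ ≤ 4 * Real.pi * ‖slotAmp W₁ j‖ * ‖y‖ := by
  have henv := slotEnvelope_mem_Icc W₁ j t
  have hα : ‖starRingEnd ℂ (slotAmp W₁ j)‖ = ‖slotAmp W₁ j‖ := Complex.norm_conj _
  rw [feedback, smul_apply, add_apply, smul_apply, smul_apply,
    norm_smul]
  have hc : ‖2 * (Real.pi : ℂ) * Complex.I * ((slotEnvelope W₁ j t : ℝ) : ℂ)‖ ≤ 2 * Real.pi := by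
    rw [norm_mul, norm_mul, norm_mul, Complex.norm_I, mul_one, Complex.norm_real, Complex.norm_real, Real.norm_eq_abs, Real.norm_eq_abs,
      abs_of_pos Real.pi_pos, abs_of_nonneg henv.1]
    have h2 : ‖(2 : ℂ)‖ = 2 := by simp
    rw [h2]
    nlinarith [henv.2, Real.pi_pos]
  have hv : ‖slotAmp W₁ j • coordL R (-(W₁.phase j).m) y + starRingEnd ℂ (slotAmp W₁ j) • coordL R (W₁.phase j).m y‖ ≤ 2 * ‖slotAmp W₁ j‖ * ‖y‖ := by
    refine (norm_add_le _ _).trans ?_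
    rw [norm_smul, norm_smul, hα]
    have h1 := norm_coordL_le (-(W₁.phase j).m) y
    have h2 := norm_coordL_le (W₁.phase j).m y
    nlinarith [norm_nonneg (slotAmp W₁ j)]
  calc _ ≤ (2 * Real.pi) * (2 * ‖slotAmp W₁ j‖ * ‖y‖) := mul_le_mul hc hv (norm_nonneg _) (by positivity)
    _ = 4 * Real.pi * ‖slotAmp W₁ j‖ * ‖y‖ := by ring

/-! ## §2 The source defect `D2` -/

/-- Components of the source defect: `(sourceXⱼ x)_z − P_{k_z}((sourceⱼ x)_z) = [z = ±mⱼ]·c_±•P_{k_z}(x − P_z x)`. [cite: MajdaKramer1999, §2.2.1.3] -/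
theorem sourceXComp_sub_proj_sourceComp (W₁ : LatticeWord k₀) (n : ℕ) (ℓ : Fin 3 → ℤ) {R : ℕ} (j : Fin k₀) (t : ℝ) (z : box R)
    (x : EuclideanSpace ℂ (Fin 3)) :
    sourceXComp W₁ n ℓ R j t z x - transversalProj (classFreq n ℓ z.1) (sourceComp W₁ R j t z x) =
      (if z.1 = (W₁.phase j).m then
          (-(2 * Real.pi * Complex.I * ((slotEnvelope W₁ j t : ℝ) : ℂ) * slotAmp W₁ j)) • transversalProj (classFreq n ℓ z.1) (x - transversalProj z.1 x)
        else 0) +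
      (if z.1 = -(W₁.phase j).m then
          (-(2 * Real.pi * Complex.I * ((slotEnvelope W₁ j t : ℝ) : ℂ) * starRingEnd ℂ (slotAmp W₁ j))) •
            transversalProj (classFreq n ℓ z.1) (x - transversalProj z.1 x)
        else 0) := by
  rw [sourceXComp, sourceComp, add_apply, add_apply, map_add]
  have key : ∀ (c : ℂ) (P : Prop) [Decidable P],
      (if P then c • transversalProj (classFreq n ℓ z.1) else (0 : EuclideanSpace ℂ (Fin 3) →L[ℂ] EuclideanSpace ℂ (Fin 3))) x -
        transversalProj (classFreq n ℓ z.1) ((if P then c • transversalProj z.1 else (0 : EuclideanSpace ℂ (Fin 3) →L[ℂ] EuclideanSpace ℂ (Fin 3))) x)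
      = if P then c • transversalProj (classFreq n ℓ z.1) (x - transversalProj z.1 x) else 0 := by
    intro c P _
    split_ifs
    · rw [smul_apply, smul_apply, map_smul, map_sub, smul_sub]
    · simp
  rw [← key, ← key]
  abel

/-- **THE SOURCE DEFECT IS `O(|ξ|/|mⱼ|)`**: `‖sourceXⱼ(t) x − projX (sourceⱼ(t) x)‖ ≤ 4π‖αⱼ‖·(√|ℓ|²/(n√|mⱼ|²))·‖x‖` (`n ≥ 1`).
[cite: MajdaKramer1999, §2.2.1.3 (cell problem (49), source term)] -/
theorem norm_sourceX_sub_projX_source_le (W₁ : LatticeWord k₀) {n : ℕ} (hn : n ≠ 0) (ℓ : Fin 3 → ℤ) {R : ℕ} (j : Fin k₀) (t : ℝ)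
    (x : EuclideanSpace ℂ (Fin 3)) :
    ‖sourceX W₁ n ℓ R j t x - projX n ℓ R (source W₁ R j t x)‖ ≤
      4 * Real.pi * ‖slotAmp W₁ j‖ * (Real.sqrt (freqNormSq ℓ) / (n * Real.sqrt (freqNormSq (W₁.phase j).m))) * ‖x‖ := by
  classical
  have hn0 : (0 : ℝ) < n := by exact_mod_cast Nat.pos_of_ne_zero hn
  have hm0 : (W₁.phase j).m ≠ 0 := (W₁.phase j).m_ne
  have hM : 0 < Real.sqrt (freqNormSq (W₁.phase j).m) := Real.sqrt_pos.2 (freqNormSq_pos_of_ne_zero' hm0)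
  have henv := slotEnvelope_mem_Icc W₁ j t
  set ρ : ℝ := Real.sqrt (freqNormSq ℓ) / (n * Real.sqrt (freqNormSq (W₁.phase j).m)) with hρ
  have hρ0 : 0 ≤ ρ := by positivity
  set a : ℝ := 2 * Real.pi * ‖slotAmp W₁ j‖ * ρ * ‖x‖ with ha
  have ha0 : 0 ≤ a := by positivity
  -- the projection estimate at `z = ±mⱼ`
  have hproj : ∀ w : Fin 3 → ℤ, (w = (W₁.phase j).m ∨ w = -(W₁.phase j).m) →
      ‖transversalProj (classFreq n ℓ w) (x - transversalProj w x)‖ ≤ ρ * ‖x‖ := by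
    intro w hw
    have hw0 : w ≠ 0 := by
      rcases hw with h | h
      · rw [h]; exact hm0
      · rw [h]; exact neg_ne_zero.2 hm0
    have hnw : classFreq n 0 w ≠ 0 := by
      intro h; apply hw0; funext i; have := congrFun h i
      simp only [classFreq_zero_left, Pi.zero_apply, mul_eq_zero, Int.natCast_eq_zero] at this; exact this.resolve_left hn
    rw [← transversalProj_classFreq_zero hn w x]
    have h := norm_transversalProj_sub_proj_le (classFreq n ℓ w) hnw x
    rw [classFreq_sub_classFreq_zero, freqNormSq_classFreq_zero, Real.sqrt_mul (sq_nonneg _), Real.sqrt_sq hn0.le] at h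
    have hfw : freqNormSq w = freqNormSq (W₁.phase j).m := by
      rcases hw with h | h <;> rw [h]; rw [freqNormSq_neg]
    rw [hfw] at h
    exact h
  have hc : ∀ c : ℂ, ‖c‖ = ‖slotAmp W₁ j‖ →
      ‖-(2 * Real.pi * Complex.I * ((slotEnvelope W₁ j t : ℝ) : ℂ) * c)‖ ≤ 2 * Real.pi * ‖slotAmp W₁ j‖ := by
    intro c hcn
    rw [norm_neg, norm_mul, norm_mul, norm_mul, norm_mul, Complex.norm_I, mul_one, Complex.norm_real, Complex.norm_real, Real.norm_eq_abs,
      Real.norm_eq_abs, abs_of_pos Real.pi_pos, abs_of_nonneg henv.1, hcn]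
    have h2 : ‖(2 : ℂ)‖ = 2 := by simp
    rw [h2]
    calc 2 * Real.pi * slotEnvelope W₁ j t * ‖slotAmp W₁ j‖ ≤ 2 * Real.pi * 1 * ‖slotAmp W₁ j‖ := by gcongr; exact henv.2
      _ = 2 * Real.pi * ‖slotAmp W₁ j‖ := by ring
  -- componentwise bound
  have hcomp : ∀ z : box R, ‖(sourceX W₁ n ℓ R j t x - projX n ℓ R (source W₁ R j t x)) z‖ ≤
      ((if (z : Fin 3 → ℤ) = (W₁.phase j).m then 1 else 0) + (if (z : Fin 3 → ℤ) = -(W₁.phase j).m then 1 else 0)) * a := by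
    intro z
    rw [PiLp.sub_apply, sourceX_apply, projX_apply, source_apply, sourceXComp_sub_proj_sourceComp]
    refine (norm_add_le _ _).trans ?_
    rw [add_mul]
    gcongr
    · split_ifs with h
      · rw [norm_smul, one_mul, ha]
        calc _ ≤ (2 * Real.pi * ‖slotAmp W₁ j‖) * (ρ * ‖x‖) := mul_le_mul (hc _ rfl) (hproj _ (Or.inl h)) (norm_nonneg _) (by positivity)
          _ = _ := by ring
      · simp
    · split_ifs with h
      · rw [norm_smul, one_mul, ha]
        calc _ ≤ (2 * Real.pi * ‖slotAmp W₁ j‖) * (ρ * ‖x‖) :=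
              mul_le_mul (hc _ (Complex.norm_conj _)) (hproj _ (Or.inr h)) (norm_nonneg _) (by positivity)
          _ = _ := by ring
      · simp
  have hsq : ‖sourceX W₁ n ℓ R j t x - projX n ℓ R (source W₁ R j t x)‖ ^ 2 ≤ 4 * a ^ 2 := by
    rw [PiLp.norm_sq_eq_of_L2]
    have hz : ∀ z : box R, ‖(sourceX W₁ n ℓ R j t x - projX n ℓ R (source W₁ R j t x)) z‖ ^ 2 ≤
        2 * ((if (z : Fin 3 → ℤ) = (W₁.phase j).m then 1 else 0) + (if (z : Fin 3 → ℤ) = -(W₁.phase j).m then 1 else 0)) * a ^ 2 := by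
      intro z
      have h := hcomp z
      have hs : ((if (z : Fin 3 → ℤ) = (W₁.phase j).m then (1:ℝ) else 0) + (if (z : Fin 3 → ℤ) = -(W₁.phase j).m then 1 else 0)) ^ 2 ≤
          2 * ((if (z : Fin 3 → ℤ) = (W₁.phase j).m then (1:ℝ) else 0) + (if (z : Fin 3 → ℤ) = -(W₁.phase j).m then 1 else 0)) := by
        split_ifs <;> norm_num
      calc _ ≤ (((if (z : Fin 3 → ℤ) = (W₁.phase j).m then (1:ℝ) else 0) + (if (z : Fin 3 → ℤ) = -(W₁.phase j).m then 1 else 0)) * a) ^ 2 :=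
            pow_le_pow_left₀ (norm_nonneg _) h 2
        _ = ((if (z : Fin 3 → ℤ) = (W₁.phase j).m then (1:ℝ) else 0) + (if (z : Fin 3 → ℤ) = -(W₁.phase j).m then 1 else 0)) ^ 2 * a ^ 2 := by ring
        _ ≤ _ := mul_le_mul_of_nonneg_right hs (sq_nonneg a)
    refine (Finset.sum_le_sum fun z _ => hz z).trans ?_
    rw [← Finset.sum_mul, ← Finset.mul_sum, Finset.sum_add_distrib]
    have h1 := sum_ite_coe_eq_le_one R (W₁.phase j).m
    have h2 := sum_ite_coe_eq_le_one R (-(W₁.phase j).m)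
    nlinarith [sq_nonneg a]
  have h4 : ‖sourceX W₁ n ℓ R j t x - projX n ℓ R (source W₁ R j t x)‖ ≤ 2 * a := by
    nlinarith [norm_nonneg (sourceX W₁ n ℓ R j t x - projX n ℓ R (source W₁ R j t x)), hsq]
  calc _ ≤ 2 * a := h4
    _ = _ := by rw [ha]; ring

/-! ## §3 The slow rate is bounded -/

/-- **`‖ẋ‖ ≤ 4π²(hi'+β'/2)|ℓ|²·‖x‖ + (Σⱼ|ξⱼ|·4π‖αⱼ‖)·‖Z‖`** for the slow rate of `…SidebandXChain.hasDerivAt_slowRep` (`x ⊥ ℓ`, window data of `𝔹`).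
[cite: Frisch1995Turbulence, §9.6.3 eq. (9.57) p. 233] [cite: MajdaKramer1999, §2.2.1.3 (55)] -/
theorem norm_slowRHS_le (W₁ : LatticeWord k₀) (n : ℕ) (ℓ : Fin 3 → ℤ) {𝔹 : Torus.Visc4 (Fin 3)} {lo' hi' β' : ℝ}
    (h𝔹 : Torus.NearIso 𝔹 lo' hi') (hlo' : 0 ≤ lo') (hhi' : 0 ≤ hi') (hodd : Torus.OddSmall 𝔹 β') (hβ' : 0 ≤ β') {R : ℕ} (t : ℝ)
    {x : EuclideanSpace ℂ (Fin 3)} (hx : kdot ℓ x = 0) (Z : Space R) :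
    ‖-(((4 * Real.pi ^ 2 : ℝ) : ℂ) • transversalProj ℓ (Torus.symbT (Torus.majorTranspose 𝔹) ℓ x)) -
        ∑ j, ((xiCoeff W₁ n ℓ j : ℝ) : ℂ) • transversalProj ℓ (feedback W₁ R j t Z)‖ ≤
      4 * Real.pi ^ 2 * (hi' + β' / 2) * freqNormSq ℓ * ‖x‖ + (∑ j, |xiCoeff W₁ n ℓ j| * (4 * Real.pi * ‖slotAmp W₁ j‖)) * ‖Z‖ := by
  have hT : Torus.NearIso (Torus.majorTranspose 𝔹) lo' hi' := (Torus.nearIso_majorTranspose_iff 𝔹 lo' hi').2 h𝔹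
  have hoddT : Torus.OddSmall (Torus.majorTranspose 𝔹) β' := by
    intro k p q hp hq
    have h := hodd k q p hq hp
    rw [Torus.bsymb_majorTranspose, Torus.bsymb_majorTranspose]
    calc (Torus.bsymb 𝔹 k q p - Torus.bsymb 𝔹 k p q) ^ 2 = (Torus.bsymb 𝔹 k q p - Torus.bsymb 𝔹 k p q) ^ 2 := rfl
      _ ≤ β' ^ 2 * ((∑ a, k a ^ 2) ^ 2 * ((∑ i, q i ^ 2) * ∑ i, p i ^ 2)) := h
      _ = β' ^ 2 * ((∑ a, k a ^ 2) ^ 2 * ((∑ i, p i ^ 2) * ∑ i, q i ^ 2)) := by ring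
  have h1 : ‖-(((4 * Real.pi ^ 2 : ℝ) : ℂ) • transversalProj ℓ (Torus.symbT (Torus.majorTranspose 𝔹) ℓ x))‖ ≤
      4 * Real.pi ^ 2 * (hi' + β' / 2) * freqNormSq ℓ * ‖x‖ := by
    rw [norm_neg, ← modalAdjGen_apply]
    exact ThreeMode.norm_modalAdjGen_le hT hlo' hhi' hoddT hβ' ℓ x hx
  have h2 : ‖∑ j, ((xiCoeff W₁ n ℓ j : ℝ) : ℂ) • transversalProj ℓ (feedback W₁ R j t Z)‖ ≤
      (∑ j, |xiCoeff W₁ n ℓ j| * (4 * Real.pi * ‖slotAmp W₁ j‖)) * ‖Z‖ := by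
    refine (norm_sum_le _ _).trans ?_
    rw [Finset.sum_mul]
    refine Finset.sum_le_sum fun j _ => ?_
    rw [norm_smul, Complex.norm_real, Real.norm_eq_abs, mul_assoc]
    refine mul_le_mul_of_nonneg_left ((norm_transversalProj_le _ _).trans (norm_feedback_apply_le W₁ R j t Z)) (abs_nonneg _)
  exact (norm_sub_le _ _).trans (add_le_add h1 h2)

end Summit.AnomalousDissipation.AnomalousDissipation.Theorems.SolenoidalFractalHomogenisation.LagrangianStep.Sideband

end
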